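import Summits.BirchSwinnertonDyer.BirchSwinnertonDyer.Theorems.GenusKolyvaginAtTwoGenusPrimitiveSupplyAtTwoPosDiscShallowKFourPosCellCapitulation
import Summits.BirchSwinnertonDyer.BirchSwinnertonDyer.Theorems.GenusKolyvaginAtTwoGenusPrimitiveSupplyAtTwoUnramifiedExactDescent
import HarnessLib

/-!
# Route `GenusKolyvaginAtTwo`, residual `OffCutResidualAtTwoR` (stmt-BirchSwinnertonDyer-31767) / crux 25504 (Δ>0 supply): THE K₄⁺-CELL
# CAPITULATION PACKAGE WITHOUT «`2` split in `K`» — `d_K` odd puts `2` split (`d_K ≡ 1 (8)`) or inert (`d_K ≡ 5 (8)`, then `2 ∤ N`)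

Width seat `bsd-line-gk2-p5` g38 (cell `bsd-f1-sign2`), sequel of this lineage's g34–g35 files `…PosDiscShallowKFourPosCellShaTwoRank` /
`…ShaStructure` / `…Capitulation` (which carry the binder `((Ideal.span {2}).primesOver (𝓞 K)).ncard = 2`) and of the g38 files `…PrimeTwistUnramifiedTwo`,
`…UnramifiedExactDescent`.  THEOREMS ONLY (no definition, no named fact, no `sorry`); helper `--supports stmt-BirchSwinnertonDyer-31767`; no item is closed;
**BSD is NOT proved by any of this.**

WHY.  LINE 27's stub S2 (crux `OffCutResidualAtTwoR`) is typed on the shallow `Δ > 0` Heegner frame WITHOUT a clause on the prime `2` of `K`; LEAD's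
S2 (SOC) theorem `sharedSocle_of_realTrivialSocle_of_splitTwo` needed «`2` split» only through g34 §1 `descAdmissible_discr_of_allSilentTwin` and its
consumers.  Here the same package is re-threaded on `Odd (discr K)` alone:

* §W1 `descAdmissibleUnram_discr_of_allSilentTwin` — `2` NOT split (`d_K` odd, Heegner, `C(E)` odd, `ord₂ C(Wd) = 0`) ⟹ `F1Sign2.DescAdmissibleUnram E d_K`
  (`d_K ≡ 5 (8)` by Stickelberger + Kronecker; `E` good at `2` since Heegner would split a bad `2`; primes of `d_K` silent by the twin Tamagawa identity);
  **`descAdmissible_or_unram_discr_of_allSilentTwin`** — NO clause at `2`: `DescAdmissible E d_K ∨ DescAdmissibleUnram E d_K`.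
* §W2 `natCard_fixedSelmer_eq_four_of_oddDiscr`, **`existsUnique_mem_selmerGroup_resTorsion_eq_of_oddDiscr`** — `#Sel₂(E_K/K)^{σ₀} = 4` and the UNIQUE
  DESCENT of an invariant `2`-Selmer class of `E_K` to `Sel₂(E/ℚ)` on the K₄⁺ cell, `2`-clause-free (Kramer's invariant part in the class-free form
  `GenusKolyArch.mem_selmerGroup_and_conjAct_eq_iff_exists_mem_relaxed_of_descAdmissible_or_unram`).
* §W3 **`existsUnique_resTorsion_eq_kummer_of_oddDiscr`**, **`existsUnique_resTorsion_eq_kummer_of_depth_pos_of_oddDiscr`** — the Kummer class of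
  `y_K/2^{M₀}` descends to a unique non-zero `s_y ∈ Sel₂(E/ℚ)`, `2`-clause-free (statements of g35's `…_of_kFourPos` / `…_of_depth_pos` with the
  binder `h2K` DELETED).

Honest framing: Kramer 1981 Thm. 1 / Gross 1991 §5 bookkeeping; KNOWN in print; kernel-new; beyond-print theorem: no.  What it buys: LEAD's S2 (SOC)
VERBATIM (sequel file).  BSD is NOT proved by any of this; `OffCutResidualAtTwoR`, K4Pos and crux 25504 stay OPEN.

References: [Kramer1981] Thm. 1, §2 Prop. 3, Prop. 6; [GrossLMS1991] §4 (4.1), §5 (5.1), Prop. 5.3; [McCallumLMS1991] §5 Lemma 5.1; [Cox2013] §5.B Prop. 5.16;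
[SilvermanAEC2009] Thm. X.4.2; [Serre1973] Ch. II §3.3.
-/

set_option linter.dupNamespace false -- `Summit.<P>.<Sub>` repeats `BirchSwinnertonDyer` (D-0017)
set_option autoImplicit false

noncomputable section

open scoped Classical NumberField

namespace Summit.BirchSwinnertonDyer.BirchSwinnertonDyer.Theorems.GenusSupplyNarrow.KFourPosCell

open WeierstrassCurve NumberField IsDedekindDomain Field Function
open Literature.NumberTheory.EllipticCurves Literature.NumberTheory.GaloisRepresentations
open Literature.NumberTheory.GaloisCohomology Literature.NumberTheory.EllipticCurves.ModularForms
open Summit.BirchSwinnertonDyer.Rank1Residual.F1Sign2 (DescAdmissible DescAdmissibleUnram NoRationalTwoTorsion selmerGroupRelaxedAtInfinityAtTwo)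
open Summit.BirchSwinnertonDyer.BirchSwinnertonDyer.Theorems.GenusExact.PlusDescent
open Summit.BirchSwinnertonDyer.BirchSwinnertonDyer.Theorems.GenusSupplyNarrow

/-! ## §W1 `d_K` is descent-admissible in one of the two senses on the all-silent frame — no clause at `2` -/

section Admissible

variable (W : WeierstrassCurve ℚ) [W.IsElliptic] [W.IsGloballyMinimal] {K : Type} [Field K] [NumberField K]

/-- **`d_K` is UNRAMIFIED-ADMISSIBLE for `E` on the all-silent frame when `2` is NOT split in `K`.**  `E/ℚ` globally minimal with `C(E)` odd; `K` imaginary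
quadratic with odd `d_K`, Heegner for `N_E`, `#{𝔭 ∣ 2} ≠ 2`; `Wd = Cd • E^{(d_K)}` elliptic with `ord₂ C(Wd) = 0`.  Then `F1Sign2.DescAdmissibleUnram E d_K`:
`d_K < 0`, squarefree; `d_K ≡ 1 (mod 4)` (Stickelberger) and `≢ 1 (mod 8)` (else `2` splits, Kronecker), so `d_K ≡ 5 (mod 8)`; `E` is GOOD at `2`
(a bad `2` would divide `N` and split by the Heegner hypothesis); every prime `q ∣ d_K` is odd, good, with `a_q` odd (the twin Tamagawa identity
`∏_{q ∣ d_K}(#roots_q + 1) = 2^{ord₂ C(Wd)} = 1`); `(d_K/ℓ) = 1` at every odd bad `ℓ` (Heegner).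
[cite: Kramer1981, §2 Prop. 3, Prop. 6] [cite: Cox2013, §5.B Prop. 5.16 (p. 105)] [cite: Serre1973, Ch. II §3.3] -/
theorem descAdmissibleUnram_discr_of_allSilentTwin (hK : IsImaginaryQuadratic K) (hodd : Odd (discr K))
    (hH : SatisfiesHeegnerHypothesis (W.conductorNorm ℤ) K) (h2K : ((Ideal.span {(2 : ℤ)}).primesOver (𝓞 K)).ncard ≠ 2)
    (hTam : Odd W.tamagawaProduct) {Wd : WeierstrassCurve ℚ} [Wd.IsElliptic] (Cd : VariableChange ℚ)
    (hCd : Cd • W.quadraticTwist (discr K : ℚ) = Wd) (hDEF : padicValNat 2 Wd.tamagawaProduct = 0) :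
    DescAdmissibleUnram W (discr K) := by
  have h2 : Module.finrank ℚ K = 2 := hK.1
  -- the split case `2 ∣ N` is excluded, so `E` is good at `2`
  have h2N : ¬ 2 ∣ W.conductorNorm ℤ := fun h ↦ h2K (by simpa only [Nat.cast_ofNat] using hH 2 Nat.prime_two h)
  have hgood2 : ∀ _h : Fact (Nat.Prime 2), W.HasGoodReductionAtPrime 2 := fun _ ↦ by
    by_contra hbad
    exact h2N ((W.dvd_conductorNorm_iff_not_hasGoodReductionAtPrime 2).mpr hbad)
  -- `d_K ≡ 5 (mod 8)`
  have h5 : discr K % 8 = 5 := by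
    have h4 : discr K % 4 = 1 := by
      rcases Literature.NumberTheory.QuadraticFields.Quadratic.discr_emod_four h2 with h0 | h1
      · exfalso
        obtain ⟨r, hr⟩ := hodd
        omega
      · exact h1
    have h81 : discr K % 8 ≠ 1 := fun h ↦
      h2K ((Literature.NumberTheory.QuadraticFields.Quadratic.ncard_primesOver_two_eq_two_iff h2).mpr h)
    omega
  -- the remaining clauses are those of g34 §1 `descAdmissible_discr_of_allSilentTwin`, verbatim
  have hprimes : ∀ q : ℕ, q.Prime → (q : ℤ) ∣ discr K →
      (∀ _h : Fact q.Prime, W.HasGoodReductionAtPrime q) ∧ Odd (W.frobeniusTrace q) := by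
    intro q hq hqd
    haveI : Fact q.Prime := ⟨hq⟩
    have hq2 : q ≠ 2 := by
      rintro rfl
      obtain ⟨r, hr⟩ := hodd
      omega
    have hqΔ : ¬ (q : ℤ) ∣ minimalDiscriminantInt W := not_dvd_minimalDiscriminantInt_of_dvd_discr_of_heegner W K h2 hH hq hq2 hqd
    refine ⟨fun _ ↦ W.hasGoodReductionAtPrime_of_not_dvd q hqΔ, (GenusKolyTwin.silent_iff_odd_frobeniusTrace W hq2 hqΔ).mp ?_⟩
    -- the factor at `q` of the Tamagawa identity is `1`: no root of the `2`-division cubic mod `q`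
    have hprod := prod_ncard_roots_add_one_eq_two_pow_padicValNat_tamagawaProduct_twin W hK hodd hH hTam Cd hCd
    rw [hDEF, pow_zero] at hprod
    have hqS : q ∈ (discr K).natAbs.primeFactors :=
      Nat.mem_primeFactors.mpr ⟨hq, Int.natCast_dvd.mp (by simpa using hqd), Int.natAbs_ne_zero.mpr (NumberField.discr_ne_zero K)⟩
    have h1 : ({x : ZMod q | 4 * x ^ 3 + ((integralModelInt W).b₂ : ZMod q) * x ^ 2 +
        2 * ((integralModelInt W).b₄ : ZMod q) * x + ((integralModelInt W).b₆ : ZMod q) = 0}.ncard + 1) ∣ 1 := by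
      have h := Finset.dvd_prod_of_mem (fun q : ℕ ↦ ({x : ZMod q | 4 * x ^ 3 + ((integralModelInt W).b₂ : ZMod q) * x ^ 2 +
        2 * ((integralModelInt W).b₄ : ZMod q) * x + ((integralModelInt W).b₆ : ZMod q) = 0} : Set (ZMod q)).ncard + 1) hqS
      rw [hprod] at h
      exact h
    have h0 : ({x : ZMod q | 4 * x ^ 3 + ((integralModelInt W).b₂ : ZMod q) * x ^ 2 +
        2 * ((integralModelInt W).b₄ : ZMod q) * x + ((integralModelInt W).b₆ : ZMod q) = 0} : Set (ZMod q)).ncard = 0 := by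
      have := Nat.le_of_dvd one_pos h1
      omega
    have hempty := (Set.ncard_eq_zero (Set.toFinite _)).mp h0
    intro x hx
    have hmem : x ∈ ({x : ZMod q | 4 * x ^ 3 + ((integralModelInt W).b₂ : ZMod q) * x ^ 2 +
        2 * ((integralModelInt W).b₄ : ZMod q) * x + ((integralModelInt W).b₆ : ZMod q) = 0} : Set (ZMod q)) := hx
    rw [hempty] at hmem
    exact hmem
  have hbad : ∀ ℓ : ℕ, ℓ.Prime → ℓ ≠ 2 → (∀ _h : Fact ℓ.Prime, ¬ W.HasGoodReductionAtPrime ℓ) → jacobiSym (discr K) ℓ = 1 := by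
    intro ℓ hℓ hℓ2 hbad
    haveI : Fact ℓ.Prime := ⟨hℓ⟩
    exact Literature.SatisfiesHeegnerHypothesis.jacobiSym_discr_eq_one h2 hH hℓ
      ((W.dvd_conductorNorm_iff_not_hasGoodReductionAtPrime ℓ).mpr (hbad ⟨hℓ⟩)) hℓ2
  exact ⟨IsImaginaryQuadratic.discr_neg hK, squarefree_discr_of_odd h2 hodd, h5, hgood2, hprimes, hbad⟩

/-- **`d_K` IS DESCENT-ADMISSIBLE IN ONE OF THE TWO SENSES on the all-silent frame — NO clause on the prime `2` of `K`.**  `E/ℚ` globally minimal with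
`C(E)` odd; `K` imaginary quadratic with odd `d_K`, Heegner for `N_E`; `Wd = Cd • E^{(d_K)}` elliptic with `ord₂ C(Wd) = 0`.  Then
`F1Sign2.DescAdmissible E d_K ∨ F1Sign2.DescAdmissibleUnram E d_K` (`2` split: g34 §1; `2` not split: §W1).
[cite: Kramer1981, §2 Prop. 3, Prop. 6] [cite: Cox2013, §5.B Prop. 5.16 (p. 105)] -/
theorem descAdmissible_or_unram_discr_of_allSilentTwin (hK : IsImaginaryQuadratic K) (hodd : Odd (discr K))
    (hH : SatisfiesHeegnerHypothesis (W.conductorNorm ℤ) K)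
    (hTam : Odd W.tamagawaProduct) {Wd : WeierstrassCurve ℚ} [Wd.IsElliptic] (Cd : VariableChange ℚ)
    (hCd : Cd • W.quadraticTwist (discr K : ℚ) = Wd) (hDEF : padicValNat 2 Wd.tamagawaProduct = 0) :
    DescAdmissible W (discr K) ∨ DescAdmissibleUnram W (discr K) := by
  by_cases h2K : ((Ideal.span {(2 : ℤ)}).primesOver (𝓞 K)).ncard = 2
  · exact Or.inl (descAdmissible_discr_of_allSilentTwin W hK hodd hH h2K hTam Cd hCd hDEF)
  · exact Or.inr (descAdmissibleUnram_discr_of_allSilentTwin W hK hodd hH h2K hTam Cd hCd hDEF)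

end Admissible

/-! ## §W2 Invariants and unique descent on the K₄⁺ cell, `2`-clause-free -/

section Cell

variable (W : WeierstrassCurve ℚ) [W.IsElliptic] [W.IsGloballyMinimal] (K : Type) [Field K] [NumberField K]

/-- **`#Sel₂(E_K/K)^{σ₀} = 4` ON THE K₄⁺ CELL, `2`-clause-free** (g35 `natCard_fixedSelmer_eq_four_of_kFourPos` with the binder `h2K` deleted): `E/ℚ`
globally minimal, `Δ_E > 0`, `ρ̄_{E,2}` onto, `C(E)` odd, the K₄⁺ clause; `K` imaginary quadratic, `d_K` odd, Heegner; `σ₀ ≠ 1`; `Wd = Cd • E^{(d_K)}`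
elliptic with `ord₂ C(Wd) = 0`. [cite: Kramer1981, Thm. 1] [cite: MazurRubin2010, Lemma 3.2] -/
theorem natCard_fixedSelmer_eq_four_of_oddDiscr
    (hpos : 0 < W.Δ) (hs2 : W.HasSurjectiveModNGaloisRep 2) (hTam : Odd W.tamagawaProduct)
    (h4 : Nat.card (W.selmerGroup 2) = 4 ∧ ∃ c ∈ (W.kummerSelmerStructure ((2 : ℕ) : ℤ)).selmerGroup,
      galoisCohomology.localization (W.torsionGaloisModule ((2 : ℕ) : ℤ)) (Sum.inl Rat.infinitePlace) 1 c ≠ 0)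
    (hK : IsImaginaryQuadratic K) (hodd : Odd (discr K)) (hH : SatisfiesHeegnerHypothesis (W.conductorNorm ℤ) K)
    {σ₀ : K ≃ₐ[ℚ] K} (hσ₀ : σ₀ ≠ 1)
    {Wd : WeierstrassCurve ℚ} [Wd.IsElliptic] (Cd : VariableChange ℚ) (hCd : Cd • W.quadraticTwist (discr K : ℚ) = Wd)
    (hDEF : padicValNat 2 Wd.tamagawaProduct = 0) :
    Nat.card {m : galH1Torsion (W.baseChange K) ((2 : ℕ) : ℤ) //
        m ∈ selmerGroup (W.baseChange K) ((2 : ℕ) : ℤ) ∧ conjAct W σ₀ ((2 : ℕ) : ℤ) m = m} = 4 := by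
  have h2 : Module.finrank ℚ K = 2 := hK.1
  have hsT : W.HasSurjectiveModNGaloisRep ((2 : ℤ) ^ 1) := by rw [pow_one]; exact hs2
  have hT : NoRationalTwoTorsion W := GenusKolyTwin.noRationalTwoTorsion_of_hasSurjectiveModNGaloisRep W hsT
  have hd := descAdmissible_or_unram_discr_of_allSilentTwin W hK hodd hH hTam Cd hCd hDEF
  obtain ⟨θ, hθ, hc⟩ := Literature.NumberTheory.EllipticCurves.exists_sq_eq_discr_not_mem_range K h2
  have hi : θ ^ 2 = ((discr K : ℤ) : K) := by rw [hc, map_intCast]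
  have hfix := GenusKolyArch.natCard_fixedSelmer_eq_natCard_relaxed_of_descAdmissible_or_unram W K hT hd h2 hi hθ hσ₀
  rw [selmerGroupRelaxedAtInfinityAtTwo_eq_selmerGroup_of_kFourPos W hpos h4] at hfix
  rw [hfix]
  exact h4.1

/-- **UNIQUE DESCENT OF AN INVARIANT `2`-SELMER CLASS OF `E_K` TO `Sel₂(E/ℚ)` ON THE K₄⁺ CELL, `2`-clause-free** (g35
`existsUnique_mem_selmerGroup_resTorsion_eq_of_kFourPos` with the binder `h2K` deleted): for every non-trivial `σ₀ ∈ Aut(K/ℚ)` and every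
`m ∈ Sel₂(E_K/K)` with `σ₀·m = m` there is a UNIQUE `s ∈ H¹(ℚ, E[2])` with `res_K s = m`, and it lies in `Sel₂(E/ℚ)` (§W1 + Kramer's invariant
part, class-free + the real switch on the cell; `res_K` injective as `E(K)[2] = 0`).  UNCONDITIONAL.
[cite: Kramer1981, Thm. 1, Prop. 3] [cite: MazurRubin2010, Lemma 3.2] [cite: GrossLMS1991, §5 (5.1), Prop. 6.2, §11] -/
theorem existsUnique_mem_selmerGroup_resTorsion_eq_of_oddDiscr
    (hpos : 0 < W.Δ) (hs2 : W.HasSurjectiveModNGaloisRep 2) (hTam : Odd W.tamagawaProduct)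
    (h4 : Nat.card (W.selmerGroup 2) = 4 ∧ ∃ c ∈ (W.kummerSelmerStructure ((2 : ℕ) : ℤ)).selmerGroup,
      galoisCohomology.localization (W.torsionGaloisModule ((2 : ℕ) : ℤ)) (Sum.inl Rat.infinitePlace) 1 c ≠ 0)
    (hK : IsImaginaryQuadratic K) (hodd : Odd (discr K)) (hH : SatisfiesHeegnerHypothesis (W.conductorNorm ℤ) K)
    {Wd : WeierstrassCurve ℚ} [Wd.IsElliptic] (Cd : VariableChange ℚ) (hCd : Cd • W.quadraticTwist (discr K : ℚ) = Wd)
    (hDEF : padicValNat 2 Wd.tamagawaProduct = 0)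
    {σ₀ : K ≃ₐ[ℚ] K} (hσ₀ : σ₀ ≠ 1)
    {m : galH1Torsion (W.baseChange K) ((2 : ℕ) : ℤ)} (hm : m ∈ selmerGroup (W.baseChange K) ((2 : ℕ) : ℤ))
    (hσm : conjAct W σ₀ ((2 : ℕ) : ℤ) m = m) :
    ∃! s : galH1Torsion W ((2 : ℕ) : ℤ), resTorsion W K ((2 : ℕ) : ℤ) s = m ∧ s ∈ W.selmerGroup ((2 : ℕ) : ℤ) := by
  have h2 : Module.finrank ℚ K = 2 := hK.1
  have hsT : W.HasSurjectiveModNGaloisRep ((2 : ℤ) ^ 1) := by rw [pow_one]; exact hs2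
  have hT : NoRationalTwoTorsion W := GenusKolyTwin.noRationalTwoTorsion_of_hasSurjectiveModNGaloisRep W hsT
  have hL := forall_two_smul_eq_zero_baseChange_of_kFourPos W K hs2 h2
  -- `d_K` is descent-admissible in one of the two senses (§W1)
  have hd := descAdmissible_or_unram_discr_of_allSilentTwin W hK hodd hH hTam Cd hCd hDEF
  -- a square root of `d_K` in `K`, off `ℚ`
  obtain ⟨θ, hθ, hc⟩ := Literature.NumberTheory.EllipticCurves.exists_sq_eq_discr_not_mem_range K h2
  have hi : θ ^ 2 = ((discr K : ℤ) : K) := by rw [hc, map_intCast]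
  -- Kramer's invariant part, class-free: `m = res_K x`, `x` in the ∞-relaxed group
  obtain ⟨x, hx, hxm⟩ :=
    (GenusKolyArch.mem_selmerGroup_and_conjAct_eq_iff_exists_mem_relaxed_of_descAdmissible_or_unram W K hT hd h2 hi hσ₀ m).mp ⟨hm, hσm⟩
  -- on the cell that group is `Sel₂(E)`
  rw [selmerGroupRelaxedAtInfinityAtTwo_eq_selmerGroup_of_kFourPos W hpos h4] at hx
  refine ⟨x, ⟨hxm, hx⟩, fun y hy ↦ ?_⟩
  exact GenusExact.EigenClassesFinite.resTorsion_injective_of_noTorsion W K h2 hθ hc ((2 : ℕ) : ℤ) hL (hy.1.trans hxm.symm)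

/-! ## §W3 The Kummer class of `y_K/2^{M₀}` descends to a unique non-zero `s_y ∈ Sel₂(E/ℚ)`, `2`-clause-free -/

/-- **THE KUMMER CLASS OF `Q₀ = P/2^M` DESCENDS TO A UNIQUE NON-ZERO `s_y ∈ Sel₂(E/ℚ)` ON THE K₄⁺ CELL, `2`-clause-free** (g35
`existsUnique_resTorsion_eq_kummer_of_kFourPos` with the binder `h2K` deleted).  Cell: `W/ℚ` globally minimal, `Δ > 0`, `ρ̄_{E,2}` onto, `∏ c(E)` odd,
the K₄⁺ clause; `K` imaginary quadratic, `d_K` odd, Heegner; `Wd = Cd • E^{(d_K)}` elliptic with `ord₂ C(Wd) = 0`; `τ ≠ 1`; `P ∈ E(K)` Heegner, `w(E) = +1`,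
`2^M Q₀ = P`, `Q₀ ∉ 2E(K)`.  UNCONDITIONAL. [cite: Kramer1981, Thm. 1] [cite: GrossLMS1991, §5 (5.1), Prop. 5.3] [cite: SilvermanAEC2009, Thm. X.4.2(a)] -/
theorem existsUnique_resTorsion_eq_kummer_of_oddDiscr [NeZero (W.conductorNorm ℤ)]
    (hpos : 0 < W.Δ) (hs2 : W.HasSurjectiveModNGaloisRep 2) (hTam : Odd W.tamagawaProduct)
    (h4 : Nat.card (W.selmerGroup 2) = 4 ∧ ∃ c ∈ (W.kummerSelmerStructure ((2 : ℕ) : ℤ)).selmerGroup,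
      galoisCohomology.localization (W.torsionGaloisModule ((2 : ℕ) : ℤ)) (Sum.inl Rat.infinitePlace) 1 c ≠ 0)
    (hK : IsImaginaryQuadratic K) (hodd : Odd (discr K)) (hH : SatisfiesHeegnerHypothesis (W.conductorNorm ℤ) K)
    {Wd : WeierstrassCurve ℚ} [Wd.IsElliptic] (Cd : VariableChange ℚ) (hCd : Cd • W.quadraticTwist (discr K : ℚ) = Wd)
    (hDEF : padicValNat 2 Wd.tamagawaProduct = 0) {τ : K ≃ₐ[ℚ] K} (hτ1 : τ ≠ 1)
    {P : (W.baseChange K).toAffine.Point} (hP : IsHeegnerPoint (W.conductorNorm ℤ) W K P) (hw1 : W.rootNumber = 1)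
    {M : ℕ} {Q₀ : (W.baseChange K).toAffine.Point} (hQ₀ : ((2 ^ M : ℕ) : ℤ) • Q₀ = P)
    (hndiv : ¬ ∃ R : (W.baseChange K).toAffine.Point, (2 : ℤ) • R = Q₀) :
    (∃! s : galH1Torsion W ((2 : ℕ) : ℤ),
        resTorsion W K ((2 : ℕ) : ℤ) s = kummerMapTorsion (W.baseChange K) ((2 : ℕ) : ℤ) (GenusKolyArch.hdiv_two_baseChange W K) Q₀ ∧
          s ∈ W.selmerGroup ((2 : ℕ) : ℤ)) ∧
      ∀ s : galH1Torsion W ((2 : ℕ) : ℤ),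
        resTorsion W K ((2 : ℕ) : ℤ) s = kummerMapTorsion (W.baseChange K) ((2 : ℕ) : ℤ) (GenusKolyArch.hdiv_two_baseChange W K) Q₀ → s ≠ 0 := by
  have h2 : Module.finrank ℚ K = 2 := hK.1
  have h2T := forall_two_smul_eq_zero_baseChange_of_kFourPos W K hs2 h2
  have h2T' : ∀ T : (W.baseChange K).toAffine.Point, (2 : ℤ) • T = 0 → T = 0 := fun T hT ↦ h2T T (by simpa using hT)
  have hfix := conjAct_kummerMapTorsion_eq_self_of_frame W K hK hH hP hw1 h2T' hτ1 hQ₀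
  have hSel := (W.baseChange K).kummerMapTorsion_mem_selmerGroup ((2 : ℕ) : ℤ) (GenusKolyArch.hdiv_two_baseChange W K) Q₀
  have hne := kummerMapTorsion_ne_zero_of_frame W K hndiv
  refine ⟨existsUnique_mem_selmerGroup_resTorsion_eq_of_oddDiscr W K hpos hs2 hTam h4 hK hodd hH Cd hCd hDEF hτ1 hSel hfix,
    fun s hs h0 ↦ hne ?_⟩
  rw [← hs, h0, map_zero]

/-- **ON THE K₄⁺ CELL, AT McCALLUM'S EXPONENT `M₀`, THE CLASS OF `y_K/2^{M₀}` IS A DISTINGUISHED NON-ZERO ELEMENT OF `Sel₂(E/ℚ)` — `2`-clause-free**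
(g35 `existsUnique_resTorsion_eq_kummer_of_depth_pos` with the binder `h2K` deleted).  Habitat-type hypotheses: `r_an(E) = 0`, `ρ̄_{E,2}` onto, `d_K·Δ_E ∉ ℚ²`,
`∏ c(E)` odd, `Δ > 0`, the K₄⁺ clause; `K` imaginary quadratic, `d_K` odd, Heegner, `τ ≠ 1`; `Wd = Cd • E^{(d_K)}` with `ord₂ C(Wd) = 0`; a conductor-`1`
datum `d₁` with `2^{M₀} ∥ P(1)` in `E(K[1])`.  Then there are `P₀, Q₀ ∈ E(K)` with `P₀ ↦ P(1)` Heegner, `2^{M₀}Q₀ = P₀`, `Q₀ ∉ 2E(K)`, and a UNIQUE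
`s_y ∈ H¹(ℚ, E[2])` with `res_K s_y = κ₂(Q₀)`, `s_y ∈ Sel₂(E/ℚ)`, `s_y ≠ 0`.  UNCONDITIONAL.  BSD is NOT proved by this.
[cite: GrossLMS1991, §4 (4.1), §5 Prop. 5.3] [cite: McCallumLMS1991, §5 Lemma 5.1] [cite: Kramer1981, Thm. 1] [cite: SilvermanAEC2009, Thm. X.4.2(a)] -/
theorem existsUnique_resTorsion_eq_kummer_of_depth_pos_of_oddDiscr [NeZero (W.conductorNorm ℤ)]
    (hpos : 0 < W.Δ) (hs2 : W.HasSurjectiveModNGaloisRep 2) (hTam : Odd W.tamagawaProduct)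
    (h4 : Nat.card (W.selmerGroup 2) = 4 ∧ ∃ c ∈ (W.kummerSelmerStructure ((2 : ℕ) : ℤ)).selmerGroup,
      galoisCohomology.localization (W.torsionGaloisModule ((2 : ℕ) : ℤ)) (Sum.inl Rat.infinitePlace) 1 c ≠ 0)
    (hK : IsImaginaryQuadratic K) (hodd : Odd (discr K)) (hH : SatisfiesHeegnerHypothesis (W.conductorNorm ℤ) K)
    {Wd : WeierstrassCurve ℚ} [Wd.IsElliptic] (Cd : VariableChange ℚ) (hCd : Cd • W.quadraticTwist (discr K : ℚ) = Wd)
    (hDEF : padicValNat 2 Wd.tamagawaProduct = 0) {τ : K ≃ₐ[ℚ] K} (hτ1 : τ ≠ 1)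
    (hr0 : W.analyticRank = 0) (hsq : ¬ IsSquare ((NumberField.discr K : ℚ) * W.Δ))
    (Dt : ModularParametrizationData W (W.conductorNorm ℤ)) (β : ℤ) (ι : K →+* ℂ) (d₁ : KolyvaginHeegnerData Dt β ι 1)
    {M₀ : ℕ} (hdiv : ∃ Q : (W.baseChange (ringClassField K ι 1)).toAffine.Point, ((2 ^ M₀ : ℕ) : ℤ) • Q = d₁.derivedPoint)
    (hndiv : ¬ ∃ Q : (W.baseChange (ringClassField K ι 1)).toAffine.Point, ((2 ^ (M₀ + 1) : ℕ) : ℤ) • Q = d₁.derivedPoint) :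
    ∃ P₀ Q₀ : (W.baseChange K).toAffine.Point, IsHeegnerPoint (W.conductorNorm ℤ) W K P₀ ∧
      Affine.Point.map (W' := W) (algebraMap K (ringClassField K ι 1)).toRatAlgHom P₀ = d₁.derivedPoint ∧
      ((2 ^ M₀ : ℕ) : ℤ) • Q₀ = P₀ ∧ (¬ ∃ R : (W.baseChange K).toAffine.Point, (2 : ℤ) • R = Q₀) ∧
      (∃! s : galH1Torsion W ((2 : ℕ) : ℤ),
        resTorsion W K ((2 : ℕ) : ℤ) s = kummerMapTorsion (W.baseChange K) ((2 : ℕ) : ℤ) (GenusKolyArch.hdiv_two_baseChange W K) Q₀ ∧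
          s ∈ W.selmerGroup ((2 : ℕ) : ℤ)) ∧
      ∀ s : galH1Torsion W ((2 : ℕ) : ℤ),
        resTorsion W K ((2 : ℕ) : ℤ) s = kummerMapTorsion (W.baseChange K) ((2 : ℕ) : ℤ) (GenusKolyArch.hdiv_two_baseChange W K) Q₀ → s ≠ 0 := by
  -- `E(K[1])[2] = 0`
  have htors : ∀ T : (W.baseChange (ringClassField K ι 1)).toAffine.Point, (2 : ℤ) • T = 0 → T = 0 := by
    intro T hT
    have h := GenusExact.torsionBy_two_ringClassField_eq_bot W hK ι one_ne_zero hs2 hsq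
    have hT' : T ∈ AddSubgroup.torsionBy (W.baseChange (ringClassField K ι 1)).toAffine.Point ((2 : ℕ) : ℤ) :=
      (Submodule.mem_torsionBy_iff _ T).mpr (by exact_mod_cast hT)
    rw [h] at hT'
    exact (AddSubgroup.mem_bot).mp hT'
  -- the Heegner point `P₀ ∈ E(K)` under `P(1)`, `w(E) = +1`
  obtain ⟨P₀, hP₀H, hP₀⟩ := heegnerSystem_exists_isHeegnerPoint_map_eq_derivedPoint_one
    (heegnerPointOfConductor_one_galoisConj_holds (W.conductorNorm ℤ) W K) hK hH d₁
  have hw1 : W.rootNumber = 1 := W.rootNumber_eq_one_of_even_analyticRank (by rw [hr0]; exact Even.zero)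
  -- McCallum 5.1: `2^{M₀} ∣ y_K` in `E(K)`, `2^{M₀+1} ∤ y_K` in `E(K)`
  have hdivK : ∃ Q₀ : (W.baseChange K).toAffine.Point, ((2 ^ M₀ : ℕ) : ℤ) • Q₀ = P₀ := by
    obtain ⟨Q, hQ⟩ := hdiv
    obtain ⟨Q₀, hQ₀⟩ := (McCallum1991.exists_pow_smul_eq_derivedPoint_one_iff hK d₁ (p := 2) htors hP₀ M₀).mp
      ⟨Q, by simpa only [Nat.cast_pow, Nat.cast_ofNat] using hQ⟩
    exact ⟨Q₀, by simpa only [Nat.cast_pow, Nat.cast_ofNat] using hQ₀⟩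
  have hndivK : ¬ ∃ Q₁ : (W.baseChange K).toAffine.Point, ((2 ^ (M₀ + 1) : ℕ) : ℤ) • Q₁ = P₀ := by
    rintro ⟨Q₁, hQ₁⟩
    refine hndiv ?_
    obtain ⟨Q, hQ⟩ := (McCallum1991.exists_pow_smul_eq_derivedPoint_one_iff hK d₁ (p := 2) htors hP₀ (M₀ + 1)).mpr
      ⟨Q₁, by simpa only [Nat.cast_pow, Nat.cast_ofNat] using hQ₁⟩
    exact ⟨Q, by simpa only [Nat.cast_pow, Nat.cast_ofNat] using hQ⟩
  obtain ⟨Q₀, hQ₀⟩ := hdivK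
  have hQ₀ndiv : ¬ ∃ R : (W.baseChange K).toAffine.Point, (2 : ℤ) • R = Q₀ := by
    rintro ⟨R, hR⟩
    refine hndivK ⟨R, ?_⟩
    have h22 : ((2 ^ (M₀ + 1) : ℕ) : ℤ) = ((2 ^ M₀ : ℕ) : ℤ) * 2 := by push_cast; ring
    rw [h22, mul_smul, hR, hQ₀]
  exact ⟨P₀, Q₀, hP₀H, hP₀, hQ₀, hQ₀ndiv,
    existsUnique_resTorsion_eq_kummer_of_oddDiscr W K hpos hs2 hTam h4 hK hodd hH Cd hCd hDEF hτ1 hP₀H hw1 hQ₀ hQ₀ndiv⟩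

end Cell

end Summit.BirchSwinnertonDyer.BirchSwinnertonDyer.Theorems.GenusSupplyNarrow.KFourPosCell

end
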